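import Literature.AlgebraicGeometry.Crystalline.HuComplexesPresentation
import Literature.Algebra.Homology.StupidFiltration
import HarnessLib

/-!
# The truncations `σ≤(r-1)` of the staircase de Rham complexes and of the presentation of X. Hu's complexes

Continuation of `Crystalline/HuComplexesPresentation`. X. Hu's complex
`p^{r,M}_{r,N}Ω• = huComplex X q r M N` (arXiv:2507.12458, Def. 8.2) has no terms in degrees `≥ r`
(`isZero_huComplex_X`, `isStrictlyLE_huComplexInt`), while the staircase de Rham complexes
`q^{(r-•)M}Ω• = deRhamStaircase X q r M` presenting it (`huPresentationInt_shortExact`: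
`0 → q^{(r-•)N}Ω• → q^{(r-•)M}Ω• → p^{r,M}_{r,N}Ω• → 0`) continue with `Ωʳ → Ωʳ⁺¹ → ⋯`. For the
lattice lemmas of line `hu` of crux `FormalLiftingFromClassLifting` (route
`HodgeConjecture/PadicSemiregularLift`) only the columns `j ≤ r - 1` may enter (for `d = 3` the
others would drag in `H²(Ω²)`, `H¹(Ω³)`, for which the crux has no torsion-freeness hypothesis), so
this file passes to the STUPID TRUNCATIONS `σ≤(r-1)` (`Literature.Algebra.Homology.stupidTruncLE`,
Mathlib's `stupidTrunc` along `ComplexShape.embeddingUpIntLE (r-1)`):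

* generic: the stupid truncation functor along any embedding of complex shapes preserves short
  exact sequences of complexes (`shortExact_map_restrictionFunctor`,
  `shortExact_map_stupidTruncFunctor`) and commutes with integer multiples
  (`stupidTruncMap_zsmul`, `stupidTruncMap_zsmul_id`);
* `deRhamStaircaseTrunc X q r M = σ≤(r-1) q^{(r-•)M}Ω•` and `huComplexTrunc X q r M N =
  σ≤(r-1) p^{r,M}_{r,N}Ω•`, the latter ISOMORPHIC to `huComplexInt X q r M N` by the projection
  `huComplexTruncπ` (`isIso_huComplexTruncπ`), naturally (`huComplexTruncπ_naturality_reduce/LE`);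
* **the truncated presentation** `huPresentationTrunc X q r h` (`M ≤ N`):
  `0 → σ≤(r-1) q^{(r-•)N}Ω• → σ≤(r-1) q^{(r-•)M}Ω• → σ≤(r-1) p^{r,M}_{r,N}Ω• → 0`, short exact
  (`huPresentationTrunc_shortExact`), with its objects / maps (rfl lemmas), `IsStrictlyGE 0`
  instances (for hyper-Ext), and naturality over Hu's reductions (`huPresentationTruncMapOfLE`);
* **the retraction identities** of `Algebra/Homology/StaircaseRetraction` transported to the
  staircase de Rham complexes, `ℤ`-extended and truncated: with `ψ_N : Ω• → q^{(r-•)N}Ω•`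
  (`deRhamStaircaseRetraction`) one has `(q^{(r-•)N} ⊆ q^{(r-•)M}) ≫ (q^{(r-•)M} ⊆ Ω•) ≫ ψ_N =
  q^{rN} • 𝟙` (`deRhamStaircaseLE_comp_ι_comp_retraction`, `…Int…`, `…Trunc…`), so that every
  additive invariant (hypercohomology) of the inclusion `σ≤(r-1) q^{(r-•)N}Ω• → σ≤(r-1) q^{(r-•)M}Ω•`
  is injective as soon as the source has no `q^{rN}`-torsion.

[folklore] Everything is proved; no named facts. NOT here: hypercohomology statements (sequel
`KTheory/HuHypercohomologyCriteria`), the chain-level division of the inclusions by `q^{N-M}` on the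
truncations.
-/

noncomputable section

/-! ### Generic: stupid truncation preserves short exactness and integer multiples -/

namespace Literature.Algebra.Homology

open CategoryTheory CategoryTheory.Limits

universe v' u'

variable {𝒜 : Type u'} [Category.{v'} 𝒜] [Abelian 𝒜]
variable {ι ι' : Type*} {c : ComplexShape ι} {c' : ComplexShape ι'} (e : c.Embedding c') [e.IsRelIff]

/-- The stupid truncation functor preserves zero morphisms (it is `restriction ⋙ extend`).
[folklore] -/
instance preservesZeroMorphisms_stupidTruncFunctor :
    (e.stupidTruncFunctor 𝒜).PreservesZeroMorphisms where
  map_zero K L := by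
    change (e.extendFunctor 𝒜).map ((e.restrictionFunctor 𝒜).map (0 : K ⟶ L)) = 0
    rw [Functor.map_zero, Functor.map_zero]

/-- The stupid truncation functor is additive (it is `restriction ⋙ extend`). [folklore] -/
instance additive_stupidTruncFunctor : (e.stupidTruncFunctor 𝒜).Additive where
  map_add {K L f g} := by
    change (e.extendFunctor 𝒜).map ((e.restrictionFunctor 𝒜).map (f + g)) =
      (e.extendFunctor 𝒜).map ((e.restrictionFunctor 𝒜).map f) +
        (e.extendFunctor 𝒜).map ((e.restrictionFunctor 𝒜).map g)
    rw [Functor.map_add, Functor.map_add]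

omit [e.IsRelIff] in
/-- Extension by zero commutes with integer multiples of morphisms. [folklore] -/
theorem extendMap_zsmul {K L : HomologicalComplex 𝒜 c} (n : ℤ) (φ : K ⟶ L) :
    HomologicalComplex.extendMap (n • φ) e = n • HomologicalComplex.extendMap φ e :=
  (e.extendFunctor 𝒜).map_zsmul

/-- **Restriction along an embedding of complex shapes preserves short exactness** (degreewise it
is the original sequence in degree `e.f i`). [folklore] -/
theorem shortExact_map_restrictionFunctor {S : ShortComplex (HomologicalComplex 𝒜 c')}
    (hS : S.ShortExact) : (S.map (e.restrictionFunctor 𝒜)).ShortExact :=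
  HomologicalComplex.shortExact_of_degreewise_shortExact _ fun i ↦
    (HomologicalComplex.shortExact_iff_degreewise_shortExact S).mp hS (e.f i)

/-- **The stupid truncation functor preserves short exactness**: for a short exact sequence `S` of
`c'`-complexes and an embedding `e : c ↪ c'`, `S.map (e.stupidTruncFunctor 𝒜)` (Mathlib's
`stupidTrunc = (restriction e).extend e`) is short exact. [folklore] -/
theorem shortExact_map_stupidTruncFunctor {S : ShortComplex (HomologicalComplex 𝒜 c')}
    (hS : S.ShortExact) : (S.map (e.stupidTruncFunctor 𝒜)).ShortExact :=
  shortExact_map_extendFunctor e (shortExact_map_restrictionFunctor e hS)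

/-- The stupid truncation commutes with integer multiples of morphisms:
`σ(c • φ) = c • σ(φ)`. [folklore] -/
theorem stupidTruncMap_zsmul {K L : HomologicalComplex 𝒜 c'} (n : ℤ) (φ : K ⟶ L) :
    HomologicalComplex.stupidTruncMap (n • φ) e = n • HomologicalComplex.stupidTruncMap φ e := by
  change (e.extendFunctor 𝒜).map ((e.restrictionFunctor 𝒜).map (n • φ)) =
    n • (e.extendFunctor 𝒜).map ((e.restrictionFunctor 𝒜).map φ)
  rw [Functor.map_zsmul, Functor.map_zsmul]

/-- The stupid truncation of multiplication by an integer is multiplication by that integer: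
`σ(c • 𝟙 K) = c • 𝟙 (σ K)`. [folklore] -/
theorem stupidTruncMap_zsmul_id (K : HomologicalComplex 𝒜 c') (n : ℤ) :
    HomologicalComplex.stupidTruncMap (n • 𝟙 K) e = n • 𝟙 (K.stupidTrunc e) := by
  rw [stupidTruncMap_zsmul, HomologicalComplex.stupidTruncMap_id]

omit [e.IsRelIff] in
/-- **Staircase images for (propositionally) equal exponent functions are isomorphic**, by the two
inclusions (no casts): e.g. `q^{(r-•)·1}K ≅ q^{r-•}K` — the exponent `(r - j) * 1` of
`Crystalline.huComplexInt _ _ r 1 n` / `deRhamStaircase _ _ r 1` is not definitionally `r - j`.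
[folklore] -/
def powImageIsoOfEq (K : CochainComplex 𝒜 ℕ) (q : ℤ) {a b : ℕ → ℕ} (ha : Antitone a)
    (hb : Antitone b) (h : a = b) : powImage K q ha ≅ powImage K q hb where
  hom := powImageLE K q hb ha h.ge
  inv := powImageLE K q ha hb h.le
  hom_inv_id := by rw [powImageLE_comp, powImageLE_refl]
  inv_hom_id := by rw [powImageLE_comp, powImageLE_refl]

omit [e.IsRelIff] in
/-- `powImageIsoOfEq` is the identity over the inclusions into `K`. [folklore] -/
theorem powImageIsoOfEq_hom_comp_powImageι (K : CochainComplex 𝒜 ℕ) (q : ℤ) {a b : ℕ → ℕ}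
    (ha : Antitone a) (hb : Antitone b) (h : a = b) :
    (powImageIsoOfEq K q ha hb h).hom ≫ powImageι K q hb = powImageι K q ha :=
  powImageLE_comp_powImageι _ _ _ _ _

end Literature.Algebra.Homology

namespace Literature.AlgebraicGeometry.Crystalline

open CategoryTheory CategoryTheory.Limits _root_.AlgebraicGeometry _root_.TopologicalSpace
  Literature.Algebra.Homology

universe u

variable {A : Type u} [CommRing A] (X : Over (Spec (CommRingCat.of A))) (q : ℤ)

/-! ### The retraction `Ω• ⟶ q^{(r-•)N}Ω•` and the identities `incl ≫ ι ≫ ψ = q^{rN}` -/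

/-- The **staircase retraction** `ψ_N : Ω• ⟶ q^{(r-•)N}Ω•` (`Algebra/Homology/StaircaseRetraction.
powImageRetraction`: in degree `j`, multiplication by `q^{rN - (r-j)N}` corestricted to the image of
`q^{(r-j)N}`), a chain map with `ψ ≫ ι = ι ≫ ψ = q^{rN} • 𝟙`. [folklore] -/
abbrev deRhamStaircaseRetraction (r N : ℕ) : algebraicDeRhamComplex X ⟶ deRhamStaircase X q r N :=
  powImageRetraction (algebraicDeRhamComplex X) q (antitone_staircase r N)

/-- `(q^{(r-•)N} ⊆ Ω•) ≫ ψ_N = q^{rN} • 𝟙`. [folklore] -/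
theorem deRhamStaircaseι_comp_retraction (r N : ℕ) :
    deRhamStaircaseι X q r N ≫ deRhamStaircaseRetraction X q r N =
      (q ^ (r * N) : ℤ) • 𝟙 (deRhamStaircase X q r N) := by
  have h := powImageι_comp_powImageRetraction (algebraicDeRhamComplex X) q (antitone_staircase r N)
  simpa only [Nat.sub_zero] using h

/-- `ψ_N ≫ (q^{(r-•)N} ⊆ Ω•) = q^{rN} • 𝟙`. [folklore] -/
theorem deRhamStaircaseRetraction_comp_ι (r N : ℕ) :
    deRhamStaircaseRetraction X q r N ≫ deRhamStaircaseι X q r N =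
      (q ^ (r * N) : ℤ) • 𝟙 (algebraicDeRhamComplex X) := by
  have h := powImageRetraction_comp_powImageι (algebraicDeRhamComplex X) q (antitone_staircase r N)
  simpa only [Nat.sub_zero] using h

/-- **`(q^{(r-•)N} ⊆ q^{(r-•)M}) ≫ (q^{(r-•)M} ⊆ Ω•) ≫ ψ_N = q^{rN} • 𝟙`** for `M ≤ N`: the inclusion
of staircase de Rham complexes is invertible up to `q^{rN}`. [folklore] -/
theorem deRhamStaircaseLE_comp_ι_comp_retraction (r : ℕ) {M N : ℕ} (h : M ≤ N) :
    deRhamStaircaseLE X q r h ≫ deRhamStaircaseι X q r M ≫ deRhamStaircaseRetraction X q r N =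
      (q ^ (r * N) : ℤ) • 𝟙 (deRhamStaircase X q r N) := by
  rw [← Category.assoc, deRhamStaircaseLE_comp_deRhamStaircaseι, deRhamStaircaseι_comp_retraction]

/-- The inclusion `q^{(r-•)M}Ω• ⟶ Ω•` is a monomorphism of complexes. [folklore] -/
instance mono_deRhamStaircaseι (r M : ℕ) : Mono (deRhamStaircaseι X q r M) :=
  HomologicalComplex.mono_of_mono_f _ fun j ↦ mono_powImageι_f _ q _ j

/-- **`(q^{(r-•)M} ⊆ Ω•) ≫ ψ_N ≫ (q^{(r-•)N} ⊆ q^{(r-•)M}) = q^{rN} • 𝟙`** for `M ≤ N`: the composite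
`μ = ι_M ≫ ψ_N : q^{(r-•)M}Ω• → q^{(r-•)N}Ω•` is a two-sided inverse of the inclusion up to `q^{rN}`
(with `deRhamStaircaseLE_comp_ι_comp_retraction`). [folklore] -/
theorem deRhamStaircaseι_comp_retraction_comp_LE (r : ℕ) {M N : ℕ} (h : M ≤ N) :
    deRhamStaircaseι X q r M ≫ deRhamStaircaseRetraction X q r N ≫ deRhamStaircaseLE X q r h =
      (q ^ (r * N) : ℤ) • 𝟙 (deRhamStaircase X q r M) := by
  rw [← cancel_mono (deRhamStaircaseι X q r M), Category.assoc, Category.assoc,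
    deRhamStaircaseLE_comp_deRhamStaircaseι, deRhamStaircaseRetraction_comp_ι,
    Preadditive.comp_zsmul, Category.comp_id, Preadditive.zsmul_comp, Category.id_comp]

/-- The staircase retraction on the `ℤ`-indexed complexes. [folklore] -/
abbrev deRhamStaircaseIntRetraction (r N : ℕ) :
    (algebraicDeRhamComplex X).extend ComplexShape.embeddingUpNat ⟶ deRhamStaircaseInt X q r N :=
  HomologicalComplex.extendMap (deRhamStaircaseRetraction X q r N) ComplexShape.embeddingUpNat

/-- The `ℤ`-extended inclusions are compatible with the `ℤ`-extended inclusions into `Ω•`.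
[folklore] -/
theorem deRhamStaircaseIntLE_comp_deRhamStaircaseIntι (r : ℕ) {M N : ℕ} (h : M ≤ N) :
    deRhamStaircaseIntLE X q r h ≫ deRhamStaircaseIntι X q r M = deRhamStaircaseIntι X q r N := by
  rw [← HomologicalComplex.extendMap_comp, deRhamStaircaseLE_comp_deRhamStaircaseι]

/-- `ι ≫ ψ = q^{rN} • 𝟙` on the `ℤ`-indexed complexes. [folklore] -/
theorem deRhamStaircaseIntι_comp_retraction (r N : ℕ) :
    deRhamStaircaseIntι X q r N ≫ deRhamStaircaseIntRetraction X q r N =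
      (q ^ (r * N) : ℤ) • 𝟙 (deRhamStaircaseInt X q r N) := by
  rw [← HomologicalComplex.extendMap_comp, deRhamStaircaseι_comp_retraction,
    extendMap_zsmul, HomologicalComplex.extendMap_id]

/-- **`incl ≫ ι ≫ ψ_N = q^{rN} • 𝟙` on the `ℤ`-indexed complexes** (`M ≤ N`). [folklore] -/
theorem deRhamStaircaseIntLE_comp_ι_comp_retraction (r : ℕ) {M N : ℕ} (h : M ≤ N) :
    deRhamStaircaseIntLE X q r h ≫ deRhamStaircaseIntι X q r M ≫ deRhamStaircaseIntRetraction X q r N =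
      (q ^ (r * N) : ℤ) • 𝟙 (deRhamStaircaseInt X q r N) := by
  rw [← Category.assoc, deRhamStaircaseIntLE_comp_deRhamStaircaseIntι,
    deRhamStaircaseIntι_comp_retraction]

/-- `ι_M ≫ ψ_N ≫ incl = q^{rN} • 𝟙` on the `ℤ`-indexed complexes (`M ≤ N`). [folklore] -/
theorem deRhamStaircaseIntι_comp_retraction_comp_LE (r : ℕ) {M N : ℕ} (h : M ≤ N) :
    deRhamStaircaseIntι X q r M ≫ deRhamStaircaseIntRetraction X q r N ≫ deRhamStaircaseIntLE X q r h =
      (q ^ (r * N) : ℤ) • 𝟙 (deRhamStaircaseInt X q r M) := by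
  rw [← HomologicalComplex.extendMap_comp, ← HomologicalComplex.extendMap_comp,
    deRhamStaircaseι_comp_retraction_comp_LE, extendMap_zsmul, HomologicalComplex.extendMap_id]

/-- The Bloch–Esnault–Kerz exponent `j ↦ r - j` is antitone. [folklore] -/
theorem antitone_bek (r : ℕ) : Antitone fun j : ℕ ↦ r - j := fun _ _ hab ↦ Nat.sub_le_sub_left hab r

/-- **`q^{(r-•)·1}Ω• ≅ q^{r-•}Ω•`**: the staircase de Rham complex at `M = 1` (the object inside
`huComplexInt _ _ r 1 n`, exponent `(r - j) * 1`) is isomorphic, over `Ω•`, to the Bloch–Esnault–Kerz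
complex `p(r)Ω•` with exponent `r - j` (`Algebra/Homology/StaircaseRetraction`, BEK section) — the
bridge for results stated with the exponent `fun j ↦ r - j`. [folklore] -/
def deRhamStaircaseOneIso (r : ℕ) :
    deRhamStaircase X q r 1 ≅ powImage (algebraicDeRhamComplex X) q (antitone_bek r) :=
  powImageIsoOfEq _ q _ _ (funext fun _ ↦ Nat.mul_one _)

/-- `deRhamStaircaseOneIso` is the identity over the inclusions into `Ω•`. [folklore] -/
theorem deRhamStaircaseOneIso_hom_comp_ι (r : ℕ) :
    (deRhamStaircaseOneIso X q r).hom ≫ powImageι (algebraicDeRhamComplex X) q (antitone_bek r) =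
      deRhamStaircaseι X q r 1 :=
  powImageIsoOfEq_hom_comp_powImageι _ q _ _ _

/-- The same isomorphism on the `ℤ`-indexed complexes. [folklore] -/
def deRhamStaircaseIntOneIso (r : ℕ) :
    deRhamStaircaseInt X q r 1 ≅
      (powImage (algebraicDeRhamComplex X) q (antitone_bek r)).extend ComplexShape.embeddingUpNat :=
  (ComplexShape.embeddingUpNat.extendFunctor _).mapIso (deRhamStaircaseOneIso X q r)

/-- The same isomorphism on the truncations `σ≤(r-1)`. [folklore] -/
def deRhamStaircaseTruncOneIso (r : ℕ) :
    stupidTruncLE (deRhamStaircaseInt X q r 1) ((r : ℤ) - 1) ≅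
      stupidTruncLE ((powImage (algebraicDeRhamComplex X) q (antitone_bek r)).extend
        ComplexShape.embeddingUpNat) ((r : ℤ) - 1) :=
  ((ComplexShape.embeddingUpIntLE ((r : ℤ) - 1)).stupidTruncFunctor _).mapIso
    (deRhamStaircaseIntOneIso X q r)

/-! ### The truncations `σ≤(r-1)` -/

/-- **`σ≤(r-1) q^{(r-•)M}Ω• = [q^{rM}𝒪 → q^{(r-1)M}Ω¹ → ⋯ → q^{M}Ω^{r-1} → 0]`**, the stupid truncation
in degrees `≤ r - 1` of the (`ℤ`-extended) staircase de Rham complex: the columns `j ≤ r - 1` only.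
[folklore] -/
abbrev deRhamStaircaseTrunc (r M : ℕ) :
    CochainComplex (Sheaf (Opens.grothendieckTopology X.left) AddCommGrpCat.{u}) ℤ :=
  stupidTruncLE (deRhamStaircaseInt X q r M) ((r : ℤ) - 1)

/-- The truncated inclusion `σ≤(r-1) q^{(r-•)M'}Ω• ⟶ σ≤(r-1) q^{(r-•)M}Ω•` (`M ≤ M'`). [folklore] -/
abbrev deRhamStaircaseTruncLE (r : ℕ) {M M' : ℕ} (h : M ≤ M') :
    deRhamStaircaseTrunc X q r M' ⟶ deRhamStaircaseTrunc X q r M :=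
  stupidTruncLEMap (deRhamStaircaseIntLE X q r h) ((r : ℤ) - 1)

/-- The truncated inclusion into `σ≤(r-1) Ω•`. [folklore] -/
abbrev deRhamStaircaseTruncι (r M : ℕ) :
    deRhamStaircaseTrunc X q r M ⟶
      stupidTruncLE ((algebraicDeRhamComplex X).extend ComplexShape.embeddingUpNat) ((r : ℤ) - 1) :=
  stupidTruncLEMap (deRhamStaircaseIntι X q r M) ((r : ℤ) - 1)

/-- The truncated retraction `σ≤(r-1) Ω• ⟶ σ≤(r-1) q^{(r-•)N}Ω•`. [folklore] -/
abbrev deRhamStaircaseTruncRetraction (r N : ℕ) :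
    stupidTruncLE ((algebraicDeRhamComplex X).extend ComplexShape.embeddingUpNat) ((r : ℤ) - 1) ⟶
      deRhamStaircaseTrunc X q r N :=
  stupidTruncLEMap (deRhamStaircaseIntRetraction X q r N) ((r : ℤ) - 1)

/-- `σ≤(r-1) q^{(r-•)M}Ω•` is strictly concentrated in degrees `≥ 0`. [folklore] -/
instance isStrictlyGE_deRhamStaircaseTrunc (r M : ℕ) : (deRhamStaircaseTrunc X q r M).IsStrictlyGE 0 :=
  inferInstance

/-- `σ≤(r-1) q^{(r-•)M}Ω•` is strictly concentrated in degrees `≤ r - 1`. [folklore] -/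
instance isStrictlyLE_deRhamStaircaseTrunc (r M : ℕ) :
    (deRhamStaircaseTrunc X q r M).IsStrictlyLE ((r : ℤ) - 1) :=
  inferInstance

/-- Transitivity of the truncated inclusions. [folklore] -/
theorem deRhamStaircaseTruncLE_comp (r : ℕ) {M M' M'' : ℕ} (h : M ≤ M') (h' : M' ≤ M'') :
    deRhamStaircaseTruncLE X q r h' ≫ deRhamStaircaseTruncLE X q r h =
      deRhamStaircaseTruncLE X q r (h.trans h') := by
  rw [← HomologicalComplex.stupidTruncMap_comp, deRhamStaircaseIntLE_comp]

/-- The truncated inclusion for `M ≤ M` is the identity. [folklore] -/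
theorem deRhamStaircaseTruncLE_refl (r M : ℕ) : deRhamStaircaseTruncLE X q r (le_refl M) = 𝟙 _ := by
  rw [deRhamStaircaseTruncLE, deRhamStaircaseIntLE_refl]
  exact HomologicalComplex.stupidTruncMap_id _ _

/-- **`incl ≫ ι ≫ ψ_N = q^{rN} • 𝟙` on the truncations** (`M ≤ N`): the truncated inclusion
`σ≤(r-1) q^{(r-•)N}Ω• → σ≤(r-1) q^{(r-•)M}Ω•` is invertible up to `q^{rN}`; in particular it induces an
injection on every additive invariant without `q^{rN}`-torsion (used for hypercohomology in
`KTheory/HuHypercohomologyCriteria`). [folklore] -/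
theorem deRhamStaircaseTruncLE_comp_ι_comp_retraction (r : ℕ) {M N : ℕ} (h : M ≤ N) :
    deRhamStaircaseTruncLE X q r h ≫ deRhamStaircaseTruncι X q r M ≫
        deRhamStaircaseTruncRetraction X q r N =
      (q ^ (r * N) : ℤ) • 𝟙 (deRhamStaircaseTrunc X q r N) := by
  rw [← HomologicalComplex.stupidTruncMap_comp, ← HomologicalComplex.stupidTruncMap_comp,
    deRhamStaircaseIntLE_comp_ι_comp_retraction, stupidTruncMap_zsmul_id]

/-- `ι ≫ ψ = q^{rN} • 𝟙` on the truncations. [folklore] -/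
theorem deRhamStaircaseTruncι_comp_retraction (r N : ℕ) :
    deRhamStaircaseTruncι X q r N ≫ deRhamStaircaseTruncRetraction X q r N =
      (q ^ (r * N) : ℤ) • 𝟙 (deRhamStaircaseTrunc X q r N) := by
  rw [← HomologicalComplex.stupidTruncMap_comp, deRhamStaircaseIntι_comp_retraction,
    stupidTruncMap_zsmul_id]

/-- **`ι_M ≫ ψ_N ≫ incl = q^{rN} • 𝟙` on the truncations** (`M ≤ N`): with
`deRhamStaircaseTruncLE_comp_ι_comp_retraction`, the truncated inclusion has the two-sided inverse
`σ(ι_M) ≫ σ(ψ_N)` up to `q^{rN}` — so `q^{rN} • ℍ(σ≤ q^{(r-•)M}Ω•) ⊆ im ℍ(σ≤ q^{(r-•)N}Ω•)`. [folklore] -/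
theorem deRhamStaircaseTruncι_comp_retraction_comp_LE (r : ℕ) {M N : ℕ} (h : M ≤ N) :
    deRhamStaircaseTruncι X q r M ≫ deRhamStaircaseTruncRetraction X q r N ≫
        deRhamStaircaseTruncLE X q r h =
      (q ^ (r * N) : ℤ) • 𝟙 (deRhamStaircaseTrunc X q r M) := by
  rw [← HomologicalComplex.stupidTruncMap_comp, ← HomologicalComplex.stupidTruncMap_comp,
    deRhamStaircaseIntι_comp_retraction_comp_LE, stupidTruncMap_zsmul_id]

/-! ### Hu's complex and its truncation `σ≤(r-1)` (an isomorphism) -/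

/-- The truncation `σ≤(r-1) p^{r,M}_{r,N}Ω•` of Hu's complex (isomorphic to it, `isIso_huComplexTruncπ`).
[folklore] -/
abbrev huComplexTrunc (r M N : ℕ) :
    CochainComplex (Sheaf (Opens.grothendieckTopology X.left) AddCommGrpCat.{u}) ℤ :=
  stupidTruncLE (huComplexInt X q r M N) ((r : ℤ) - 1)

/-- The projection `p^{r,M}_{r,N}Ω• ⟶ σ≤(r-1) p^{r,M}_{r,N}Ω•`. [folklore] -/
abbrev huComplexTruncπ (r M N : ℕ) : huComplexInt X q r M N ⟶ huComplexTrunc X q r M N :=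
  stupidTruncLEπ (huComplexInt X q r M N) ((r : ℤ) - 1)

/-- **`p^{r,M}_{r,N}Ω• ⟶ σ≤(r-1) p^{r,M}_{r,N}Ω•` is an isomorphism** (Hu's complex has no terms in
degrees `≥ r`). [folklore] -/
instance isIso_huComplexTruncπ (r M N : ℕ) : IsIso (huComplexTruncπ X q r M N) :=
  isIso_stupidTruncLEπ _ _

/-- `σ≤(r-1) p^{r,M}_{r,N}Ω•` is strictly concentrated in degrees `≥ 0`. [folklore] -/
instance isStrictlyGE_huComplexTrunc (r M N : ℕ) : (huComplexTrunc X q r M N).IsStrictlyGE 0 :=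
  inferInstance

/-- Naturality of the projection with respect to Hu's reductions (`N ≤ N'`). [folklore] -/
theorem huComplexTruncπ_naturality_reduce (r M : ℕ) {N N' : ℕ} (h : N ≤ N') :
    huComplexTruncπ X q r M N' ≫ stupidTruncLEMap (huComplexIntReduce X q r M h) ((r : ℤ) - 1) =
      huComplexIntReduce X q r M h ≫ huComplexTruncπ X q r M N :=
  stupidTruncLEπ_naturality _ _

/-- Naturality of the projection with respect to Hu's inclusions (`M' ≤ M`). [folklore] -/
theorem huComplexTruncπ_naturality_LE (r : ℕ) {M M' : ℕ} (h : M' ≤ M) (N : ℕ) :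
    huComplexTruncπ X q r M N ≫ stupidTruncLEMap (huComplexIntLE X q r h N) ((r : ℤ) - 1) =
      huComplexIntLE X q r h N ≫ huComplexTruncπ X q r M' N :=
  stupidTruncLEπ_naturality _ _

/-- The projections `q^{(r-•)M}Ω• → p^{r,M}_{r,N}` followed by the truncation iso, versus the
truncated projection: `π ≫ (trunc iso) = (trunc of Ω-staircase) ≫ σ(π)`. [folklore] -/
theorem huComplexIntπ_comp_huComplexTruncπ (r M N : ℕ) :
    huComplexIntπ X q r M N ≫ huComplexTruncπ X q r M N =
      stupidTruncLEπ (deRhamStaircaseInt X q r M) ((r : ℤ) - 1) ≫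
        stupidTruncLEMap (huComplexIntπ X q r M N) ((r : ℤ) - 1) :=
  (stupidTruncLEπ_naturality _ _).symm

/-! ### The truncated presentation -/

/-- **The truncated presentation** `σ≤(r-1) q^{(r-•)N}Ω• ⟶ σ≤(r-1) q^{(r-•)M}Ω• ⟶ σ≤(r-1) p^{r,M}_{r,N}Ω•`
(`M ≤ N`), the stupid truncation of `huPresentationInt`. [folklore] -/
abbrev huPresentationTrunc (r : ℕ) {M N : ℕ} (h : M ≤ N) :
    ShortComplex (CochainComplex (Sheaf (Opens.grothendieckTopology X.left) AddCommGrpCat.{u}) ℤ) :=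
  (huPresentationInt X q r h).map
    ((ComplexShape.embeddingUpIntLE ((r : ℤ) - 1)).stupidTruncFunctor _)

/-- The objects of the truncated presentation are `deRhamStaircaseTrunc X q r N`,
`deRhamStaircaseTrunc X q r M`, `huComplexTrunc X q r M N`, and its maps are `deRhamStaircaseTruncLE`
and the truncation of `huComplexIntπ` (definitionally). [folklore] -/
theorem huPresentationTrunc_X (r : ℕ) {M N : ℕ} (h : M ≤ N) :
    (huPresentationTrunc X q r h).X₁ = deRhamStaircaseTrunc X q r N ∧
      (huPresentationTrunc X q r h).X₂ = deRhamStaircaseTrunc X q r M ∧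
        (huPresentationTrunc X q r h).X₃ = huComplexTrunc X q r M N ∧
          (huPresentationTrunc X q r h).f = deRhamStaircaseTruncLE X q r h ∧
            (huPresentationTrunc X q r h).g =
              stupidTruncLEMap (huComplexIntπ X q r M N) ((r : ℤ) - 1) :=
  ⟨rfl, rfl, rfl, rfl, rfl⟩

/-- The objects of the truncated presentation are strictly concentrated in degrees `≥ 0`
(instances, for the hyper-Ext smallness conditions). [folklore] -/
instance isStrictlyGE_huPresentationTrunc_X₁ (r : ℕ) {M N : ℕ} (h : M ≤ N) :
    CochainComplex.IsStrictlyGE (huPresentationTrunc X q r h).X₁ 0 :=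
  isStrictlyGE_deRhamStaircaseTrunc X q r N

/-- See `isStrictlyGE_huPresentationTrunc_X₁`. [folklore] -/
instance isStrictlyGE_huPresentationTrunc_X₂ (r : ℕ) {M N : ℕ} (h : M ≤ N) :
    CochainComplex.IsStrictlyGE (huPresentationTrunc X q r h).X₂ 0 :=
  isStrictlyGE_deRhamStaircaseTrunc X q r M

/-- See `isStrictlyGE_huPresentationTrunc_X₁`. [folklore] -/
instance isStrictlyGE_huPresentationTrunc_X₃ (r : ℕ) {M N : ℕ} (h : M ≤ N) :
    CochainComplex.IsStrictlyGE (huPresentationTrunc X q r h).X₃ 0 :=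
  isStrictlyGE_huComplexTrunc X q r M N

/-- **The truncated presentation is short exact**:
`0 → σ≤(r-1) q^{(r-•)N}Ω• → σ≤(r-1) q^{(r-•)M}Ω• → σ≤(r-1) p^{r,M}_{r,N}Ω• → 0` (`M ≤ N`). [folklore] -/
theorem huPresentationTrunc_shortExact (r : ℕ) {M N : ℕ} (h : M ≤ N) :
    (huPresentationTrunc X q r h).ShortExact :=
  shortExact_map_stupidTruncFunctor _ (huPresentationInt_shortExact X q r h)

/-- **Naturality of the truncated presentation over Hu's reductions** (`M ≤ N ≤ N'`): components
`deRhamStaircaseTruncLE X q r h'`, `𝟙`, and the truncation of `huComplexIntReduce X q r M h'`.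
[folklore] -/
abbrev huPresentationTruncMapOfLE (r : ℕ) {M N N' : ℕ} (h : M ≤ N) (h' : N ≤ N') :
    huPresentationTrunc X q r (h.trans h') ⟶ huPresentationTrunc X q r h :=
  ((ComplexShape.embeddingUpIntLE ((r : ℤ) - 1)).stupidTruncFunctor _).mapShortComplex.map
    (huPresentationIntMapOfLE X q r h h')

/-- The components of `huPresentationTruncMapOfLE`. [folklore] -/
theorem huPresentationTruncMapOfLE_τ (r : ℕ) {M N N' : ℕ} (h : M ≤ N) (h' : N ≤ N') :
    (huPresentationTruncMapOfLE X q r h h').τ₁ = deRhamStaircaseTruncLE X q r h' ∧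
      (huPresentationTruncMapOfLE X q r h h').τ₂ = 𝟙 _ ∧
        (huPresentationTruncMapOfLE X q r h h').τ₃ =
          stupidTruncLEMap (huComplexIntReduce X q r M h') ((r : ℤ) - 1) := by
  refine ⟨rfl, ?_, rfl⟩
  change HomologicalComplex.stupidTruncMap (HomologicalComplex.extendMap (𝟙 (deRhamStaircase X q r M))
    ComplexShape.embeddingUpNat) (ComplexShape.embeddingUpIntLE ((r : ℤ) - 1)) =
    𝟙 (deRhamStaircaseTrunc X q r M)
  rw [HomologicalComplex.extendMap_id]
  exact HomologicalComplex.stupidTruncMap_id _ _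

/-- **Naturality of the truncated presentation over Hu's inclusions** (`M' ≤ M ≤ N`): components
`𝟙`, `deRhamStaircaseTruncLE X q r h'`, and the truncation of `huComplexIntLE X q r h' N`.
[folklore] -/
abbrev huPresentationTruncMapOfLE' (r : ℕ) {M M' N : ℕ} (h' : M' ≤ M) (h : M ≤ N) :
    huPresentationTrunc X q r h ⟶ huPresentationTrunc X q r (h'.trans h) :=
  ((ComplexShape.embeddingUpIntLE ((r : ℤ) - 1)).stupidTruncFunctor _).mapShortComplex.map
    (huPresentationIntMapOfLE' X q r h' h)

/-- The components of `huPresentationTruncMapOfLE'`. [folklore] -/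
theorem huPresentationTruncMapOfLE'_τ (r : ℕ) {M M' N : ℕ} (h' : M' ≤ M) (h : M ≤ N) :
    (huPresentationTruncMapOfLE' X q r h' h).τ₁ = 𝟙 _ ∧
      (huPresentationTruncMapOfLE' X q r h' h).τ₂ = deRhamStaircaseTruncLE X q r h' ∧
        (huPresentationTruncMapOfLE' X q r h' h).τ₃ =
          stupidTruncLEMap (huComplexIntLE X q r h' N) ((r : ℤ) - 1) := by
  refine ⟨?_, rfl, rfl⟩
  change HomologicalComplex.stupidTruncMap (HomologicalComplex.extendMap (𝟙 (deRhamStaircase X q r N))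
    ComplexShape.embeddingUpNat) (ComplexShape.embeddingUpIntLE ((r : ℤ) - 1)) =
    𝟙 (deRhamStaircaseTrunc X q r N)
  rw [HomologicalComplex.extendMap_id]
  exact HomologicalComplex.stupidTruncMap_id _ _

end Literature.AlgebraicGeometry.Crystalline

end
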